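import Literature.Analysis.FluidPDE.MillerMiddleEigenvalueSup
import HarnessLib

/-!
# Miller's enstrophy Grönwall inequality with an `L^∞_x` majorant of the middle principal strain
# (Neustupa–Penel 2001 / Miller 2019, endpoint `q = ∞`, `p = 1`)

Analysis/FluidPDE proofs file (theorems only).  Twin of the tree's `miller_enstrophy_le_mul_exp`
(`MillerMiddleEigenvalueGronwall.lean`, `3/2 < r < ∞`) at the endpoint `r = ∞`: for a classical solution of the
unforced Navier–Stokes system on `[0, T] × ℝ³` in Tao's `L²`-Sobolev class and a TIME-ONLY majorant `m(t) ≥ 0` of the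
middle principal strain, `λ₂(∇u(t,x)) ≤ m(t)` for all `x` (two-frame Courant–Fischer form) with `∫₀ˢ m < ∞`,

* `miller_enstrophy_le_mul_exp_sup` — `∫ |∇u(s)|²_F ≤ exp (4 ∫₀ˢ m(t) dt) ∫ |∇u(0)|²_F`

(enstrophy balance + the slice bound `integral_sum_inner_fderiv_le_of_momentum_of_midStrain_le` + Grönwall in `ℝ≥0∞`).
With `m(t) = ε/(T−t)` this is the polynomial bound `‖∇u(s)‖² ≤ (T/(T−s))^{4ε} ‖∇u(0)‖²` behind the cell nsreg-p1
ROUND-15 rung (ii); the factor `4` comes from the tree's pointwise Lemma 5.1 (`2 λ₂⁺ |∇v|²_F`), Miller's sharp `2`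
needs the global identity `∫|∇u|² = 2∫|S|²`.
References: Miller, ARMA 235 (2020) = arXiv:1710.05569, Thm 1.1 [Miller2019]; Neustupa–Penel 2001, Thm 2 [NeustupaPenel2001].
-/

noncomputable section
open MeasureTheory Set Function Filter Topology InnerProductSpace
open scoped ENNReal NNReal ContDiff RealInnerProductSpace Laplacian Matrix

namespace Literature.Analysis.FluidPDE

set_option maxHeartbeats 400000 in
/-- **Miller's enstrophy inequality with an `L^∞_x` strain majorant** (endpoint `q = ∞` of Miller 2019 Thm 1.1 /
Neustupa–Penel 2001 Thm 2): `∫ |∇u(s)|²_F ≤ exp (4 ∫₀ˢ m) ∫ |∇u(0)|²_F` when `λ₂(∇u(t,·)) ≤ m(t)` on `(0,s)`.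
[cite: Miller2019, Thm 1.1 (proof of Thm 5.2)] [cite: NeustupaPenel2001, Thm 2] -/
theorem miller_enstrophy_le_mul_exp_sup {ν T : ℝ} (hν : 0 < ν) (hT : 0 < T)
    {u : ℝ → EuclideanSpace ℝ (Fin 3) → EuclideanSpace ℝ (Fin 3)}
    {p : ℝ → EuclideanSpace ℝ (Fin 3) → ℝ} (hsol : FluidPDE.IsClassicalNSSolutionOn (Icc 0 T) ν 0 u p)
    (hu : HasBoundedSobolevNormsOn (Icc 0 T) u)
    (hut : HasBoundedSobolevNormsOn (Icc 0 T) (FluidPDE.timeDerivWithin (Icc 0 T) u))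
    (hp : ∀ n : ℕ, ∃ C : ℝ≥0, ∀ t ∈ Icc 0 T, ∫⁻ x, ‖iteratedFDeriv ℝ n (p t) x‖ₑ ^ 2 ≤ C)
    {m : ℝ → ℝ} (hm0 : ∀ t, 0 ≤ m t)
    {s : ℝ} (hs : s ∈ Ioc 0 T)
    (hmaj : ∀ t ∈ Ioo 0 s, ∀ x, ∃ y z : EuclideanSpace ℝ (Fin 3), ‖y‖ = 1 ∧ ‖z‖ = 1 ∧
      ⟪y, z⟫ = 0 ∧ ∀ α β : ℝ,
        ⟪fderiv ℝ (u t) x (α • y + β • z), α • y + β • z⟫ ≤ m t * (α ^ 2 + β ^ 2))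
    (hA : ∫⁻ t in Ioo 0 s, ENNReal.ofReal (m t) ≠ ⊤) :
    ∫⁻ x, ENNReal.ofReal (FluidPDE.frobeniusNormSq (fderiv ℝ (u s) x)) ≤
      ENNReal.ofReal (Real.exp (4 * (∫⁻ t in Ioo 0 s, ENNReal.ofReal (m t)).toReal)) *
        ∫⁻ x, ENNReal.ofReal (FluidPDE.frobeniusNormSq (fderiv ℝ (u 0) x)) := by
  set e := EuclideanSpace.basisFun (Fin 3) ℝ with he
  have hU : UniqueDiffOn ℝ (Icc 0 T) := uniqueDiffOn_Icc hT
  set W : ℝ → EuclideanSpace ℝ (Fin 3) → EuclideanSpace ℝ (Fin 3) :=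
    FluidPDE.timeDerivWithin (Icc 0 T) u with hW
  have hWsm : FluidPDE.IsSmoothSpaceTimeOn (Icc 0 T) W := hsol.smooth_velocity.timeDerivWithin hU
  -- pointwise bounds on `u` and `Du` over the slab (Sobolev)
  obtain ⟨B₀, hB₀⟩ := linfty_bound_of_hasBoundedSobolevNormsOn_holds
    (fun t ht => (hsol.contDiff_velocity ht).of_le (by norm_cast)) hu
  obtain ⟨B₁, -, hB₁⟩ := exists_forall_norm_fderiv_le_of_hasBoundedSobolevNormsOn
    (fun t ht => (hsol.contDiff_velocity ht).of_le (by norm_cast)) hu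
  obtain ⟨C₁, hC₁⟩ := hu 1
  obtain ⟨D₂, hD₂⟩ := hu 2
  obtain ⟨D₃, hD₃⟩ := hu 3
  obtain ⟨E₀, hE₀⟩ := hut 0
  obtain ⟨E₁, hE₁⟩ := hut 1
  obtain ⟨P₀, hP₀⟩ := hp 0
  obtain ⟨P₁, hP₁⟩ := hp 1
  have hzero : ∀ {f : EuclideanSpace ℝ (Fin 3) → EuclideanSpace ℝ (Fin 3)} {C' : ℝ≥0},
      (∫⁻ x, ‖iteratedFDeriv ℝ 0 f x‖ₑ ^ 2 ≤ C') → ∫⁻ x, ‖f x‖ₑ ^ 2 < ⊤ := by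
    intro f C' h
    refine lt_of_le_of_lt ((le_of_eq (lintegral_congr fun x => ?_)).trans h) ENNReal.coe_lt_top
    rw [← ofReal_norm, ← ofReal_norm, norm_iteratedFDeriv_zero]
  have hzero' : ∀ {f : EuclideanSpace ℝ (Fin 3) → ℝ} {C' : ℝ≥0},
      (∫⁻ x, ‖iteratedFDeriv ℝ 0 f x‖ₑ ^ 2 ≤ C') → ∫⁻ x, ‖f x‖ₑ ^ 2 < ⊤ := by
    intro f C' h
    refine lt_of_le_of_lt ((le_of_eq (lintegral_congr fun x => ?_)).trans h) ENNReal.coe_lt_top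
    rw [← ofReal_norm, ← ofReal_norm, norm_iteratedFDeriv_zero]
  -- the enstrophy balance
  obtain ⟨hΦint, hGcont, hGb⟩ := hsol.smooth_velocity.enstrophy_balance hT hC₁ hE₁
  set Φ : ℝ → ℝ := fun t => ∫ x, 2 * ∑ i, ⟪fderiv ℝ (u t) x (e i), fderiv ℝ (W t) x (e i)⟫ with hΦ
  set G : ℝ → ℝ := fun t => ∫ x, FluidPDE.frobeniusNormSq (fderiv ℝ (u t) x) with hG
  have hG0 : ∀ t, 0 ≤ G t := fun t => integral_nonneg fun x => FluidPDE.frobeniusNormSq_nonneg _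
  have hfrob_le : ∀ t ∈ Icc 0 T,
      ∫⁻ x, ENNReal.ofReal (FluidPDE.frobeniusNormSq (fderiv ℝ (u t) x)) ≤ 3 * C₁ := by
    intro t ht
    calc ∫⁻ x, ENNReal.ofReal (FluidPDE.frobeniusNormSq (fderiv ℝ (u t) x))
        ≤ ∫⁻ x, 3 * ‖iteratedFDeriv ℝ 1 (u t) x‖ₑ ^ 2 := lintegral_mono fun x => by
          rw [← ofReal_norm, norm_iteratedFDeriv_one, ofReal_norm]
          exact ofReal_frobeniusNormSq_le_three_mul_enorm_sq _
      _ = 3 * ∫⁻ x, ‖iteratedFDeriv ℝ 1 (u t) x‖ₑ ^ 2 := lintegral_const_mul' _ _ (by norm_num)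
      _ ≤ 3 * C₁ := by gcongr; exact hC₁ t ht
  have hfrob_lt : ∀ t ∈ Icc 0 T,
      ∫⁻ x, ENNReal.ofReal (FluidPDE.frobeniusNormSq (fderiv ℝ (u t) x)) < ⊤ := fun t ht =>
    lt_of_le_of_lt (hfrob_le t ht) (ENNReal.mul_lt_top (by norm_num) ENNReal.coe_lt_top)
  have ifrob : ∀ t ∈ Icc 0 T, Integrable (fun x => FluidPDE.frobeniusNormSq (fderiv ℝ (u t) x)) volume :=
    fun t ht => integrable_of_continuous_of_nonneg
      (FluidPDE.continuous_frobeniusNormSq_fderiv (hsol.contDiff_velocity ht) (by simp))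
      (fun x => FluidPDE.frobeniusNormSq_nonneg _) (hfrob_lt t ht)
  have hGeq : ∀ t ∈ Icc 0 T, ENNReal.ofReal (G t) =
      ∫⁻ x, ENNReal.ofReal (FluidPDE.frobeniusNormSq (fderiv ℝ (u t) x)) := fun t ht =>
    ofReal_integral_eq_lintegral_ofReal (ifrob t ht)
      (Eventually.of_forall fun x => FluidPDE.frobeniusNormSq_nonneg _)
  -- the Grönwall density `4 m(t)`
  -- the production bound at interior times: `Φ t ≤ 4 m(t) G t`
  have hslice : ∀ t ∈ Ioo 0 s, Φ t ≤ 4 * m t * G t := by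
    intro t ht
    have htI : t ∈ Icc 0 T := ⟨ht.1.le, ht.2.le.trans hs.2⟩
    have hmom : ∀ x, W t x + FluidPDE.convect (u t) (u t) x = ν • (Δ (u t)) x - gradient (p t) x := by
      intro x
      have h := hsol.momentum t htI x
      simpa [hW] using h
    have hsl := integral_sum_inner_fderiv_le_of_momentum_of_midStrain_le
      (hsol.contDiff_velocity htI)
      ((hWsm.contDiff_slice htI).of_le (by norm_cast))
      ((hsol.contDiff_pressure htI).of_le (by norm_cast)) hmom (hsol.divFree t htI)
      (fun x => hB₀ t htI x) (fun x => hB₁ t htI x) (hm0 t) (hmaj t ht)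
      ((hC₁ t htI).trans_lt ENNReal.coe_lt_top) ((hD₂ t htI).trans_lt ENNReal.coe_lt_top)
      ((hD₃ t htI).trans_lt ENNReal.coe_lt_top)
      (hzero (hE₀ t htI)) ((hE₁ t htI).trans_lt ENNReal.coe_lt_top)
      (hzero' (hP₀ t htI)) ((hP₁ t htI).trans_lt ENNReal.coe_lt_top)
    have h2 : Φ t = 2 * ∫ x, ∑ i, ⟪fderiv ℝ (u t) x (e i), fderiv ℝ (W t) x (e i)⟫ := by
      rw [hΦ]
      exact integral_const_mul _ _
    rw [h2]
    have hL2 : 0 ≤ ∫ x, ‖(Δ (u t)) x‖ ^ 2 := integral_nonneg fun x => sq_nonneg _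
    have hG' : G t = ∫ x, FluidPDE.frobeniusNormSq (fderiv ℝ (u t) x) := rfl
    rw [hG']
    nlinarith [hsl, hL2, hν, hG0 t, hm0 t]
  -- Grönwall in `ℝ≥0∞`
  set φE : ℝ → ℝ≥0∞ := fun t => ENNReal.ofReal (G t) with hφE
  set aE : ℝ → ℝ≥0∞ := fun t => ENNReal.ofReal (4 * m t) with haE
  have hM : ∀ t ∈ Icc 0 s, φE t ≤ 3 * C₁ := fun t ht => by
    rw [hφE]; simp only; rw [hGeq t ⟨ht.1, ht.2.trans hs.2⟩]
    exact hfrob_le t ⟨ht.1, ht.2.trans hs.2⟩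
  have haE4 : ∀ t, aE t = ENNReal.ofReal 4 * ENNReal.ofReal (m t) := fun t => by
    rw [haE]; simp only; rw [ENNReal.ofReal_mul (by norm_num)]
  have haS : ∫⁻ t in Ioo 0 s, aE t ≠ ⊤ := by
    simp_rw [haE4]
    rw [lintegral_const_mul' _ _ ENNReal.ofReal_ne_top]
    exact ENNReal.mul_ne_top ENNReal.ofReal_ne_top hA
  -- the pointwise comparison `ofReal (Φ τ) ≤ aE τ * φE τ` at every `τ ∈ (0, s)`
  have hcmp : ∀ τ ∈ Ioo 0 s, ENNReal.ofReal (Φ τ) ≤ aE τ * φE τ := by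
    intro τ hτs
    calc ENNReal.ofReal (Φ τ) ≤ ENNReal.ofReal (4 * m τ * G τ) := ENNReal.ofReal_le_ofReal (hslice τ hτs)
      _ = aE τ * φE τ := by
          rw [haE, hφE]; simp only
          rw [ENNReal.ofReal_mul (mul_nonneg (by norm_num) (hm0 τ))]
  have hineq : ∀ t ∈ Icc 0 s, φE t ≤ φE 0 + ∫⁻ τ in Ioo 0 t, aE τ * φE τ := by
    intro t ht
    rcases eq_or_lt_of_le ht.1 with h0 | ht0
    · rw [← h0]; simp
    have htT : t ∈ Ioc 0 T := ⟨ht0, ht.2.trans hs.2⟩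
    -- `ofReal (∫ Φ) ≤ ∫⁻ ofReal Φ ≤ ∫⁻ a φ`
    have hΦt : IntegrableOn Φ (Ioo 0 t) volume := hΦint.mono_set (Ioo_subset_Ioo le_rfl htT.2)
    have h1 : ENNReal.ofReal (∫ τ in Ioo 0 t, Φ τ) ≤ ∫⁻ τ in Ioo 0 t, ENNReal.ofReal (Φ τ) := by
      calc ENNReal.ofReal (∫ τ in Ioo 0 t, Φ τ) ≤ ENNReal.ofReal (∫ τ in Ioo 0 t, max (Φ τ) 0) :=
            ENNReal.ofReal_le_ofReal (integral_mono hΦt hΦt.pos_part fun τ => le_max_left _ _)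
        _ = ∫⁻ τ in Ioo 0 t, ENNReal.ofReal (max (Φ τ) 0) :=
            ofReal_integral_eq_lintegral_ofReal hΦt.pos_part (Eventually.of_forall fun τ => le_max_right _ _)
        _ = ∫⁻ τ in Ioo 0 t, ENNReal.ofReal (Φ τ) := lintegral_congr fun τ => by
            rcases le_total (Φ τ) 0 with h | h
            · rw [max_eq_right h, ENNReal.ofReal_zero, ENNReal.ofReal_of_nonpos h]
            · rw [max_eq_left h]
    have h2 : ∫⁻ τ in Ioo 0 t, ENNReal.ofReal (Φ τ) ≤ ∫⁻ τ in Ioo 0 t, aE τ * φE τ := by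
      refine lintegral_mono_ae ((ae_restrict_iff' measurableSet_Ioo).2 (Eventually.of_forall ?_))
      intro τ hτt
      exact hcmp τ ⟨hτt.1, hτt.2.trans_le ht.2⟩
    calc φE t = ENNReal.ofReal (G 0 + ∫ τ in (0 : ℝ)..t, Φ τ) := by
          rw [hφE]; simp only; congr 1; exact hGb t htT
      _ ≤ ENNReal.ofReal (G 0) + ENNReal.ofReal (∫ τ in (0 : ℝ)..t, Φ τ) := ENNReal.ofReal_add_le
      _ = φE 0 + ENNReal.ofReal (∫ τ in Ioo 0 t, Φ τ) := by
          rw [intervalIntegral.integral_of_le ht.1, integral_Ioc_eq_integral_Ioo]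
      _ ≤ φE 0 + ∫⁻ τ in Ioo 0 t, aE τ * φE τ := by gcongr; exact h1.trans h2
  have hgron := lintegral_gronwall_le (S := s) ENNReal.ofReal_ne_top
    (ENNReal.mul_ne_top (by norm_num) ENNReal.coe_ne_top) hM haS hineq s ⟨hs.1.le, le_rfl⟩
  -- unpack
  have hint_a : (∫⁻ τ in Ioo 0 s, aE τ).toReal = 4 * (∫⁻ t in Ioo 0 s, ENNReal.ofReal (m t)).toReal := by
    simp_rw [haE4]
    rw [lintegral_const_mul' _ _ ENNReal.ofReal_ne_top, ENNReal.toReal_mul,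
      ENNReal.toReal_ofReal (by norm_num : (0:ℝ) ≤ 4)]
  rw [hint_a] at hgron
  rw [← hGeq s ⟨hs.1.le, hs.2⟩, ← hGeq 0 ⟨le_rfl, hT.le⟩, mul_comm]
  convert hgron using 3


end Literature.Analysis.FluidPDE

end
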